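import Summits.ABC.StewartYu.GenThreeFrameSpecOdd
import Summits.ABC.StewartYu.GenThreeStepOddRat
import Summits.ABC.StewartYu.GenThreeFrameSpecTwoRat
import Summits.ABC.StewartYu.GenThreeBaseOdd
import Mathlib.Analysis.SpecialFunctions.Pow.Real
import HarnessLib

/-!
# Cell abc-stewartyu, WP-L.P(odd) (crux r3 `PadicCoreOddRat`, stmt-ABC-20503): the Kummer-free FRAME SPEC at odd `p` — the crux text from
# «zero estimate + frame at the real roots `ξ = α^{1/N}` + record», ranks `0, 1` elementary

`Summits/ABC/StewartYu/GenThreeFrameSpecOddRat.lean` — cell `abc-stewartyu` (HOME `run/shared/lean/pub/abc-stewartyu/`, design memo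
HOME/p2/memo-07-WPLP-odd-Nframe-design.md §1 (L4), §2 rows «shells» / «output/END»; seat p2-g6; shell S4-odd).  Theorems and one `Prop`-valued
definition; no named fact.  The Kummer-free odd twin of p4-g3's `GenThreeFrameSpecOdd`, on p3-g9's shared layer (`GenThreeEndReal.exists_exits_units`
— the END for ANY independent complex units —, `GenThreeEndReal.rpowUnit`, `GenThreeFrameSpecTwoRat.FrameOutputReal`):

* `rootReal`, `rootUnitsN`, `hind_rootUnitsN`, **`ratCast_eq_prod_rootUnitsN_zpow`** — the real `N`-th roots `ξⱼ = αⱼ^{1/N}` of positive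
  rationals as complex units (`rpowUnit`), independence from that of `α`, and the DICTIONARY: a positive rational `g` with `g^N = ∏ αⱼ^{νⱼ}` IS
  `∏ ξⱼ^{νⱼ}` in `ℂ` — so the saturated frame's last-level identities in `θ^{μx}` (`(θ^μ)^N = α^{ν}`, `SatCoords.prod_zpow_pow_eq`) are
  identities at `(x, ξˣ)` with INTEGER exponents `ν = μ ᵥ* U` (print's `ξ = α^{1/N}`, Nesterenko p. 125 (5.3)–(5.4));
* `FrameOddRatPos C p n` — for every rank-`n` Kummer-FREE datum with POSITIVE generators under the negated bound, SOME pivot, parameters and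
  independent complex units `ξ` with `FrameOutputReal ∧ RecordOdd` (the landed record predicate VERBATIM — it never mentions the generators);
* **`dichotomyOddRatPos_of_frame`** (zero estimate + frame ⇒ dichotomy, via `exists_exits_units` and the `q = 1` step `stepOddRatPos_of_exitC`),
  `dichotomyOddRatPos_zero/one` (ranks `0, 1`: vacuous / the one-logarithm estimate, copy of `GenThreeBaseOdd.dichotomyOdd_one` whose Kummer
  binder was unused), `coreOddRatPos_mono`, **`padicCoreOddRatText_of_frame`**, **`padicCoreOddRatText_of_frame_two_le`** — the crux text
  (`GenThreeInductionOddRat.PadicCoreOddRatText` = `Theses.YuMatveevShapeRat.PadicCoreOddRat` verbatim) from `Nesterenko2003_prop51`, an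
  admissible `0 ≤ C r ≤ c₁ʳ` with `2 ≤ C 1`, and the positive frame at every odd prime and every rank `n ≥ 2` (constant `4c₁`, squaring).

WHAT THIS IS NOT: the frame, the record; no crux moves.

References: Yu. V. Nesterenko, LNM 1819 (2003), §5.1–5.2 (5.3)–(5.17), Lemmas 5.2–5.4, (5.22); K. Yu, Forum Math. 19 (2007); Compositio 74 (1990) §1.1.
-/

noncomputable section

open Finset
open Literature.NumberTheory.Transcendental
open Literature.NumberTheory.Transcendental.GaGm

namespace Summit.ABC.StewartYu.GenThreeFrameSpecOddRat

open Summit.ABC.StewartYu.GenThreeEndExits (span_rat_of_exitC pos_of_exitC)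
open Summit.ABC.StewartYu.GenThreeEndReal (rpowUnit val_rpowUnit hind_units_of_rpow_rat exists_exits_units)
open Summit.ABC.StewartYu.GenThreeInductionOddRat
open Summit.ABC.StewartYu.GenThreeFrameSpecOdd (RecordOdd)
open Summit.ABC.StewartYu.GenThreeFrameSpecTwo (bHyperplane mem_bHyperplane)
open Summit.ABC.StewartYu.GenThreeFrameSpecTwoRat (FrameOutputReal)

variable {m : ℕ}

/-! ### The real roots `ξ = α^{1/N}` as complex units -/

/-- The real `N`-th root of a positive rational: `(α : ℝ)^{1/N}`. [folklore] -/
def rootReal (N : ℕ) (α : Fin m → ℚ) (j : Fin m) : ℝ := ((α j : ℚ) : ℝ) ^ ((1 : ℝ) / N)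

/-- It is positive. [folklore] -/
theorem rootReal_pos (N : ℕ) (α : Fin m → ℚ) (hα : ∀ j, 0 < α j) (j : Fin m) : 0 < rootReal N α j := by
  unfold rootReal
  exact Real.rpow_pos_of_pos (by exact_mod_cast hα j) _

/-- `(αⱼ^{1/N})^N = αⱼ`. [folklore] -/
theorem rootReal_pow (N : ℕ) (hN : 0 < N) (α : Fin m → ℚ) (hα : ∀ j, 0 < α j) (j : Fin m) :
    rootReal N α j ^ N = ((α j : ℚ) : ℝ) := by
  unfold rootReal
  have hα0 : (0 : ℝ) ≤ ((α j : ℚ) : ℝ) := by exact_mod_cast (hα j).le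
  rw [← Real.rpow_natCast, ← Real.rpow_mul hα0]
  have hN' : (N : ℝ) ≠ 0 := by exact_mod_cast hN.ne'
  rw [one_div_mul_cancel hN', Real.rpow_one]

/-- Multiplicative independence of the roots from that of the rationals. [folklore] -/
theorem hind_rootReal (N : ℕ) (hN : 0 < N) (α : Fin m → ℚ) (hα : ∀ j, 0 < α j)
    (hind : ∀ φ : Fin m → ℤ, ∏ j, α j ^ φ j = 1 → φ = 0) :
    ∀ φ : Fin m → ℤ, ∏ j, rootReal N α j ^ φ j = 1 → φ = 0 := by
  intro φ h
  apply hind φ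
  have h1 : (∏ j, rootReal N α j ^ φ j) ^ N = 1 := by rw [h, one_pow]
  rw [← Finset.prod_pow] at h1
  have h2 : ∀ j, (rootReal N α j ^ φ j) ^ N = (((α j : ℚ) : ℝ)) ^ φ j := by
    intro j
    rw [← zpow_natCast, ← zpow_mul, mul_comm, zpow_mul, zpow_natCast, rootReal_pow N hN α hα j]
  simp only [h2] at h1
  have h3 : (((∏ j, α j ^ φ j : ℚ)) : ℝ) = ((1 : ℚ) : ℝ) := by push_cast; exact h1
  exact_mod_cast h3

/-- The root units `ξⱼ = αⱼ^{1/N}` as complex units (p3's `rpowUnit` at exponent `1/N`). [cite: Nesterenko2003, §5 (5.4): ξⱼ = αⱼ^{1/N}] -/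
def rootUnitsN (N : ℕ) (α : Fin m → ℚ) (hα : ∀ j, 0 < α j) (j : Fin m) : ℂˣ :=
  rpowUnit ((α j : ℚ) : ℝ) (by exact_mod_cast hα j) ((1 : ℝ) / N)

/-- Its value is the cast real root. [folklore] -/
theorem val_rootUnitsN (N : ℕ) (α : Fin m → ℚ) (hα : ∀ j, 0 < α j) (j : Fin m) :
    ((rootUnitsN N α hα j : ℂˣ) : ℂ) = ((rootReal N α j : ℝ) : ℂ) := rfl

/-- Independence of the root units (`1/N ≠ 0`). [folklore] -/
theorem hind_rootUnitsN (N : ℕ) (hN : 0 < N) (α : Fin m → ℚ) (hα : ∀ j, 0 < α j)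
    (hind : ∀ φ : Fin m → ℤ, ∏ j, α j ^ φ j = 1 → φ = 0) :
    ∀ φ : Fin m → ℤ, ∏ j, rootUnitsN N α hα j ^ φ j = 1 → φ = 0 :=
  hind_units_of_rpow_rat α hα hind (one_div_ne_zero (by exact_mod_cast hN.ne'))

/-- **The saturated frame's monomials at the root point**: a positive rational `g` with `g^N = ∏ αⱼ^{νⱼ}` equals `∏ ξⱼ^{νⱼ}` in `ℂ`
(`ξ = α^{1/N}`; both are positive reals with the same `N`-th power). With `g = θ^μ`, `ν = μ ᵥ* U` (`SatCoords.prod_zpow_pow_eq`) this turns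
the frame's identities in `θ^{μx}` into identities at `(x, ξˣ)` with integer exponents. [cite: Nesterenko2003, §5 (5.3)–(5.4)] -/
theorem ratCast_eq_prod_rootUnitsN_zpow (N : ℕ) (hN : 0 < N) (α : Fin m → ℚ) (hα : ∀ j, 0 < α j)
    (g : ℚ) (hg : 0 < g) (ν : Fin m → ℤ) (hgN : g ^ N = ∏ j, α j ^ ν j) :
    ((g : ℚ) : ℂ) = ∏ j, ((rootUnitsN N α hα j : ℂˣ) : ℂ) ^ ν j := by
  -- compare the positive reals `g` and `∏ ξⱼ^{νⱼ}` through their `N`-th powers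
  have hpos : ∀ j, 0 < rootReal N α j := rootReal_pos N α hα
  have hR : ((g : ℚ) : ℝ) = ∏ j, rootReal N α j ^ ν j := by
    have h1 : (0 : ℝ) ≤ ((g : ℚ) : ℝ) := by exact_mod_cast hg.le
    have h2 : (0 : ℝ) ≤ ∏ j, rootReal N α j ^ ν j := Finset.prod_nonneg fun j _ => (zpow_pos (hpos j) _).le
    refine (pow_left_inj₀ h1 h2 hN.ne').mp ?_
    rw [← Finset.prod_pow]
    have h3 : ∀ j, (rootReal N α j ^ ν j) ^ N = (((α j : ℚ) : ℝ)) ^ ν j := by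
      intro j
      rw [← zpow_natCast, ← zpow_mul, mul_comm, zpow_mul, zpow_natCast, rootReal_pow N hN α hα j]
    simp only [h3]
    have h4 : (((g ^ N : ℚ)) : ℝ) = (((∏ j, α j ^ ν j : ℚ)) : ℝ) := by rw [hgN]
    push_cast at h4
    exact h4
  simp only [val_rootUnitsN]
  rw [show ((g : ℚ) : ℂ) = (((g : ℚ) : ℝ) : ℂ) by push_cast; rfl, hR]
  push_cast
  rfl

/-! ### The Kummer-free frame spec -/

/-- **THE KUMMER-FREE FRAME at rank `n`, odd `p`, positive generators**: for every rank-`n` datum of `CoreOddRatPos` (positive units,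
independence, weights with floor `1`, `1 ≤ W` — NO Kummer condition) under the NEGATED bound, a pivot `b j₀ ≠ 0`, parameters, and
multiplicatively independent complex units `ξ` (the frame takes `ξ = α^{1/N}` for the saturation index `N`) with the frame output at `(x, ξˣ)`
(`FrameOutputReal`, p3) and the landed odd-`p` record obligations. [cite: Nesterenko2003, §5 with §3.5/§4.3 (𝔑); shape only] -/
def FrameOddRatPos (C : ℕ → ℝ) (p n : ℕ) : Prop :=
  ∀ (α : Fin n → ℚ) (b : Fin n → ℤ) (V : Fin n → ℝ) (Vmax W : ℝ),
    (∀ j, 0 < α j) → (∀ j, α j ≠ 0 ∧ padicValRat p (α j) = 0) →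
    (∀ μ : Fin n → ℤ, ∏ j, α j ^ μ j = 1 → μ = 0) →
    (∀ j, Height.logHeight₁ (α j) ≤ V j) → (∀ j, 1 ≤ V j) → (∀ j, V j ≤ Vmax) →
    b ≠ 0 → (∀ j, Real.log (max 3 (|b j| : ℝ)) ≤ W) → 1 ≤ W →
    ¬ (padicValRat p (∏ j, α j ^ b j - 1) : ℝ) * Real.log p ≤
        C n * ((p : ℝ) / Real.log p) * (∏ j, V j) * (W + Real.log p + Real.log (2 * Vmax)) →
    ∃ (j₀ : Fin n) (D₀ S₀ X : ℕ) (D : Fin n → ℕ) (ξ : Fin n → ℂˣ), b j₀ ≠ 0 ∧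
      (∀ φ : Fin n → ℤ, ∏ j, ξ j ^ φ j = 1 → φ = 0) ∧
      FrameOutputReal n ξ b j₀ D₀ S₀ X D ∧ RecordOdd C p n V Vmax W D₀ S₀ X D

/-- **The positive Kummer-free per-rank dichotomy at odd `p` from the frame.**  Zero estimate + frame output at `(x, ξˣ)` ⇒ the END with
exits (`exists_exits_units` on `𝔚 = bHyperplane b`); exit A and full rank refuted by the record; exit C with `0 < r < n` is the positive
Kummer-free Matveev step `stepOddRatPos_of_exitC` closed by the record's (5.22) line. [cite: Nesterenko2003, §5.2] -/
theorem dichotomyOddRatPos_of_frame {p n : ℕ} [Fact p.Prime] (hZ : Nesterenko2003_prop51) {C : ℕ → ℝ}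
    (hC0 : ∀ r, 0 ≤ C r) (hF : FrameOddRatPos C p n) : DichotomyOddRatPos C p n := by
  classical
  refine dichotomyOddRatPos_of_not_le ?_
  intro α b V Vmax W hpos hα hind hV hV1 hVmax hb hW hW1 hneg
  obtain ⟨j₀, D₀, S₀, X, D, ξ, hbj₀, hindξ, hout, hrecA, hrecB, hrecC⟩ :=
    hF α b V Vmax W hpos hα hind hV hV1 hVmax hb hW hW1 hneg
  obtain ⟨I, q, i₀, ha, hκ, hi₀, hq, hL⟩ := hout
  have hinj : Set.InjOn (fun i : ℕ × (Fin n → ℤ) => (i.1, i.2)) (I : Set (ℕ × (Fin n → ℤ))) := by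
    intro x _ y _ h
    exact Prod.ext (congrArg Prod.fst h) (congrArg Prod.snd h)
  obtain ⟨H, r, M, hrn, hd, hM, hchars, hexits⟩ :=
    exists_exits_units hZ ξ hindξ b j₀ hbj₀ (bHyperplane b) (mem_bHyperplane b) I Prod.fst Prod.snd q
      D₀ S₀ X D ha hκ hinj hi₀ hq hL
  rcases hexits with ⟨_hnex, hineqA⟩ | ⟨hex, hineqC⟩
  · exact absurd hineqA (hrecA r H.addDim M hrn hd hM)
  · rcases Nat.lt_or_ge r n with hlt | hge
    · have hr0 : 0 < r := pos_of_exitC b hb (fun i => M i) hex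
      have hbM := span_rat_of_exitC b (fun i => M i) hex
      exact stepOddRatPos_of_exitC hr0 hlt (hC0 r) α hpos hα hind V Vmax W hV hV1 hVmax b hb hW hW1 H
        (fun i => M i) hM hchars hbM (hrecC r H.addDim M hr0 hlt hd hM hineqC)
    · have hrn' : r = n := le_antisymm hrn hge
      subst hrn'
      exact absurd hineqC (hrecB H.addDim M hd hM)

/-! ### Ranks `0` and `1`, monotonicity in the constant -/

/-- Rank `0` of the positive Kummer-free dichotomy is vacuous (`b ≠ 0` is impossible on `Fin 0`). [folklore] -/
theorem dichotomyOddRatPos_zero (C : ℕ → ℝ) (p : ℕ) : DichotomyOddRatPos C p 0 := by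
  intro α b V Vmax W _ _ _ _ _ _ hb _ _
  exact absurd (funext fun j => Fin.elim0 j) hb

/-- **Rank `1` of the positive Kummer-free dichotomy by the elementary one-logarithm estimate** (`2 ≤ C 1`):
`ord_p(θᵐ − 1)·log p ≤ 2(p−1)·h(θ) + log|m| ≤ C(1)·(p/log p)·A·(W + log p + log 2Amax)` — the proof of `GenThreeBaseOdd.dichotomyOdd_one`
(its Kummer binder was unused). [cite: Yu1990, §1.1; shape only] -/
theorem dichotomyOddRatPos_one {p : ℕ} [Fact p.Prime] (hp2 : p ≠ 2) {C : ℕ → ℝ} (hC : 2 ≤ C 1) :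
    DichotomyOddRatPos C p 1 := by
  have hp : p.Prime := Fact.out
  intro α b V Vmax W _hpos hα hind hV hV1 hVmax hb hW hW1
  left
  have hb0 : b 0 ≠ 0 := by
    intro h0; apply hb; funext j
    have : j = 0 := Subsingleton.elim _ _
    rw [this, h0]; rfl
  obtain ⟨hθ0, hθv⟩ := hα 0
  -- `θ ≠ ±1` from multiplicative independence
  have hθ1 : α 0 ≠ 1 := by
    intro h1
    have h := hind (fun _ => 1) (by rw [Fin.prod_univ_one, h1, one_zpow])
    exact one_ne_zero (congrFun h 0)
  have hθm1 : α 0 ≠ -1 := by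
    intro h1
    have h := hind (fun _ => 2) (by
      rw [Fin.prod_univ_one, h1]; norm_num)
    have h2 := congrFun h 0
    norm_num at h2
  -- the product over `Fin 1`
  have hprod : ∏ j : Fin 1, α j ^ b j = α 0 ^ b 0 := by rw [Fin.prod_univ_one]
  have hprodV : ∏ j : Fin 1, V j = V 0 := by rw [Fin.prod_univ_one]
  rw [hprod, hprodV]
  have hest := Literature.NumberTheory.DiophantineGeometry.Dioph.padicValRat_zpow_sub_one_mul_log_le'
    hp hp2 hθ0 hθv hθ1 hθm1 hb0
  -- `log |b 0| ≤ W`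
  have hlogb : Real.log ((b 0).natAbs : ℝ) ≤ W := by
    have hcast : ((b 0).natAbs : ℝ) = |(b 0 : ℝ)| := by
      rw [Nat.cast_natAbs, Int.cast_abs]
    have hpos : (0 : ℝ) < |(b 0 : ℝ)| := abs_pos.mpr (by exact_mod_cast hb0)
    rw [hcast]
    exact (Real.log_le_log hpos (le_max_right 3 _)).trans (hW 0)
  -- numerics
  have hp1 : (1 : ℝ) < p := by exact_mod_cast hp.one_lt
  have hlogp : 0 < Real.log p := Real.log_pos hp1
  have hq1 : 1 ≤ (p : ℝ) / Real.log p := GenThreeBaseOdd.one_le_div_log hp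
  have hA1 := hV1 0
  have hA0 : 0 ≤ V 0 := by linarith
  have hAmax : 1 ≤ Vmax := hA1.trans (hVmax 0)
  have hl2V : 0 ≤ Real.log (2 * Vmax) := Real.log_nonneg (by linarith)
  have hh : Height.logHeight₁ (α 0) ≤ V 0 := hV 0
  have hstep1 : (padicValRat p (α 0 ^ b 0 - 1) : ℝ) * Real.log p ≤ 2 * ((p : ℝ) - 1) * V 0 + W := by
    have := mul_le_mul_of_nonneg_left hh (by linarith : (0 : ℝ) ≤ 2 * ((p : ℝ) - 1))
    linarith [hest, hlogb]
  have hstep2 : 2 * ((p : ℝ) - 1) * V 0 + W ≤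
      C 1 * ((p : ℝ) / Real.log p) * V 0 * (W + Real.log p + Real.log (2 * Vmax)) := by
    have e1 : (p : ℝ) / Real.log p * V 0 * Real.log p = (p : ℝ) * V 0 := by
      field_simp
    have hVW : W ≤ (p : ℝ) / Real.log p * V 0 * W := by
      have h1 : 1 ≤ (p : ℝ) / Real.log p * V 0 := by nlinarith
      nlinarith
    have hmain : 2 * ((p : ℝ) - 1) * V 0 + W ≤
        2 * ((p : ℝ) / Real.log p * V 0 * (W + Real.log p + Real.log (2 * Vmax))) := by
      have hexp : (p : ℝ) / Real.log p * V 0 * (W + Real.log p + Real.log (2 * Vmax)) =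
          (p : ℝ) / Real.log p * V 0 * W + (p : ℝ) * V 0 +
            (p : ℝ) / Real.log p * V 0 * Real.log (2 * Vmax) := by
        rw [← e1]; ring
      rw [hexp]
      have h3 : 0 ≤ (p : ℝ) / Real.log p * V 0 * Real.log (2 * Vmax) := by positivity
      nlinarith
    have hC2 : 2 * ((p : ℝ) / Real.log p * V 0 * (W + Real.log p + Real.log (2 * Vmax))) ≤
        C 1 * ((p : ℝ) / Real.log p) * V 0 * (W + Real.log p + Real.log (2 * Vmax)) := by
      have h0 : 0 ≤ (p : ℝ) / Real.log p * V 0 * (W + Real.log p + Real.log (2 * Vmax)) := by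
        have : 0 ≤ W + Real.log p + Real.log (2 * Vmax) := by linarith
        positivity
      calc 2 * ((p : ℝ) / Real.log p * V 0 * (W + Real.log p + Real.log (2 * Vmax)))
          ≤ C 1 * ((p : ℝ) / Real.log p * V 0 * (W + Real.log p + Real.log (2 * Vmax))) :=
            mul_le_mul_of_nonneg_right hC h0
        _ = C 1 * ((p : ℝ) / Real.log p) * V 0 * (W + Real.log p + Real.log (2 * Vmax)) := by ring
    exact hmain.trans hC2
  exact hstep1.trans hstep2

/-- **Monotonicity of the positive core in the constant**: `C ≤ C′` pointwise ⇒ `CoreOddRatPos C ⇒ CoreOddRatPos C′` (the right-hand side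
is non-negative when it matters). [folklore] -/
theorem coreOddRatPos_mono {C C' : ℕ → ℝ} (hCC' : ∀ r, C r ≤ C' r) {p : ℕ} [Fact p.Prime] {r : ℕ}
    (h : CoreOddRatPos C p r) : CoreOddRatPos C' p r := by
  intro θ m' A Amax W hpos hθ hind hA hA1 hAmax hm hW hW1
  refine (h θ m' A Amax W hpos hθ hind hA hA1 hAmax hm hW hW1).trans ?_
  have hr : 0 < r := by
    rcases Nat.eq_zero_or_pos r with h0 | h0
    · subst h0; exact absurd (funext fun i => Fin.elim0 i) hm
    · exact h0
  have hAmax1 : 1 ≤ Amax := (hA1 ⟨0, hr⟩).trans (hAmax ⟨0, hr⟩)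
  have hΩ : 0 ≤ ∏ i, A i := Finset.prod_nonneg fun i _ => (zero_le_one.trans (hA1 i))
  have hlogp : 0 ≤ Real.log p := Real.log_natCast_nonneg p
  have hdiv : 0 ≤ (p : ℝ) / Real.log p := GenThreeInductionOdd.div_log_nonneg p
  have hlog2A : 0 ≤ Real.log (2 * Amax) := Real.log_nonneg (by linarith)
  have hlast : 0 ≤ W + Real.log p + Real.log (2 * Amax) := by linarith
  have hfac : 0 ≤ ((p : ℝ) / Real.log p) * (∏ i, A i) * (W + Real.log p + Real.log (2 * Amax)) := by positivity
  calc C r * ((p : ℝ) / Real.log p) * (∏ i, A i) * (W + Real.log p + Real.log (2 * Amax))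
      = C r * (((p : ℝ) / Real.log p) * (∏ i, A i) * (W + Real.log p + Real.log (2 * Amax))) := by ring
    _ ≤ C' r * (((p : ℝ) / Real.log p) * (∏ i, A i) * (W + Real.log p + Real.log (2 * Amax))) :=
        mul_le_mul_of_nonneg_right (hCC' r) hfac
    _ = C' r * ((p : ℝ) / Real.log p) * (∏ i, A i) * (W + Real.log p + Real.log (2 * Amax)) := by ring

/-- **TOP-DOWN SKELETON OF WP-L.P(odd)**: RouteGA's crux text `PadicCoreOddRat` (local copy `PadicCoreOddRatText`, all signs, constant `4c`)
from the zero estimate, one constant `0 ≤ c`, and the positive Kummer-free frame at every odd prime and every rank.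
[cite: Yu2007, Main Thm (K = ℚ); shape only] -/
theorem padicCoreOddRatText_of_frame {c : ℝ} (hc : 0 ≤ c)
    (hF : Nesterenko2003_prop51 → ∀ p : ℕ, p.Prime → p ≠ 2 → ∀ n, FrameOddRatPos (fun k => c ^ k) p n)
    (hZ : Nesterenko2003_prop51) : PadicCoreOddRatText :=
  padicCoreOddRatText_of_dichotomyPos hc fun p hp hp2 n => by
    haveI : Fact p.Prime := ⟨hp⟩
    exact dichotomyOddRatPos_of_frame hZ (fun r => pow_nonneg hc r) (hF hZ p hp hp2 n)

/-- **END-TO-END, ranks split**: the crux text `PadicCoreOddRatText` (= `Theses.YuMatveevShapeRat.PadicCoreOddRat`) from the zero estimate,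
an admissible `0 ≤ C r ≤ c₁ʳ` with `2 ≤ C 1`, and the positive Kummer-free frame at every odd prime and every rank `n ≥ 2` (ranks `0, 1` by
`dichotomyOddRatPos_zero/one`; all signs by squaring, constant `4c₁`). [cite: Yu2007, Main Thm (K = ℚ); shape only] -/
theorem padicCoreOddRatText_of_frame_two_le {C : ℕ → ℝ} {c₁ : ℝ} (hC : ∀ r, 0 ≤ C r ∧ C r ≤ c₁ ^ r) (hC1 : 2 ≤ C 1)
    (hF : Nesterenko2003_prop51 → ∀ p : ℕ, p.Prime → p ≠ 2 → ∀ n, 2 ≤ n → FrameOddRatPos C p n)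
    (hZ : Nesterenko2003_prop51) : PadicCoreOddRatText := by
  have hc₁ : 0 ≤ c₁ := by
    have h := (hC 1).2
    rw [pow_one] at h
    linarith [(hC 1).1]
  refine ⟨4 * c₁, fun p hp hp2 => ?_⟩
  haveI : Fact p.Prime := ⟨hp⟩
  have hD : ∀ n, DichotomyOddRatPos C p n := fun n => by
    rcases Nat.lt_or_ge n 2 with hn | hn
    · interval_cases n
      · exact dichotomyOddRatPos_zero C p
      · exact dichotomyOddRatPos_one hp2 hC1
    · exact dichotomyOddRatPos_of_frame hZ (fun r => (hC r).1) (hF hZ p hp hp2 n hn)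
  have hcore : ∀ r, CoreOddRatPos (fun k => c₁ ^ k) p r := fun r =>
    coreOddRatPos_mono (fun r => (hC r).2) (coreRatPos_of_dichotomy hD r)
  exact coreOddRat_of_pos hc₁ hp2 hcore

end Summit.ABC.StewartYu.GenThreeFrameSpecOddRat

end
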